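import Mathlib
import HarnessLib

/-!
# Rhin–Viola 2001, §4: `ϕ, χ, ϑ, σ` as even permutations of the ten sums; the blocks `P`; `Φ → S₅`; `Θ` of order 16

Topic `Literature/NumberTheory/Irrationality/RhinViola2001`. PROVED companion (theorems and concrete
definitions only; no named fact, no `sorry`) to `GroupStructure.lean`, whose docstring lists as NOT typed:
"`|Φ| = 1920` and the `A₁₀`/`S₅` structure (a finite group computation)". First of two files: this one
types the four generators on `U = {u₁,…,u₁₀}`, the block system `P` and the homomorphism `π ↦ π*` onto
`S₅`; the sequel `PermutationGroupOrder.lean` proves `|Φ| = 1920`, `Φ = ⟨ϕ, ϑ⟩`, the kernel `(ℤ/2ℤ)⁴` and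
the 120 cosets of `Θ`. Source read on the page: G. Rhin, C. Viola, *The group structure for ζ(3)*,
Acta Arith. **97** (2001) 269–293 [RhinViola2001], §4, pp. 281–283 (held text `paper:doi-10-4064-aa97-3-6`,
p0013–p0015) and §2 p. 272 for `Θ`.

HONEST FRAMING (cells pub-zeta5 / zeta5-irr): systematic search; no irrationality claim unless certified.
Pure finite group theory about four explicit permutations of ten symbols printed in a 2001 paper on
`ζ(3)`; nothing here concerns `ζ(5)`, any measure, or any denominator.

## What is printed (pp. 281–283) and how it is typed

With `u₁,…,u₁₀` the ten sums (4.2) `h+l, j+m, k+q, l+r, m+s, q+h, r+j, s+k, j+q, k+r` (the tie to the tree's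
parameter maps `theta`, `sigma`, `phi`, `chi` of `GroupStructure.lean` is the sibling `TenSumsAction.lean`),
p. 282: "Plainly `ϕ = (u₃ u₁₀)(u₇ u₉)`, `χ = (u₂ u₃)(u₆ u₇)`, `ϑ = (u₁ u₂ u₃ u₄ u₅ u₆ u₇ u₈)(u₉ u₁₀)`,
`σ = (u₁ u₈)(u₂ u₇)(u₃ u₆)(u₄ u₅)` are even permutations of the set `U = {u₁,…,u₁₀}`. Thus we have a natural
embedding of the group `Φ = ⟨ϕ, χ, ϑ, σ⟩` in the alternating group `A₁₀` … The group `⟨ϕ, ϑ⟩` is clearly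
transitive over `U`, and therefore so is `Φ`. Moreover, let
`P = {{u₁,u₅},{u₂,u₆},{u₃,u₇},{u₄,u₈},{u₉,u₁₀}}` … `P` is a partition of `U`, and shows that the group `Φ`
is imprimitive over `U`, the elements of `P` being blocks of imprimitivity, since each of `ϕ, χ, ϑ` and `σ`
carries every element of `P` onto an element of `P`. Precisely, let … `ϕ* = ({u₃,u₇} {u₉,u₁₀})`,
`χ* = ({u₂,u₆} {u₃,u₇})`, `ϑ* = ({u₁,u₅} {u₂,u₆} {u₃,u₇} {u₄,u₈})`, `σ* = ({u₁,u₅} {u₄,u₈})({u₂,u₆} {u₃,u₇})`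
… the mapping `ϕ ↦ ϕ*, χ ↦ χ*, ϑ ↦ ϑ*` and `σ ↦ σ*` extends to a homomorphism `Φ → S₅` … the product `ϑ*ϕ*`
(i.e., the permutation of `P` obtained by applying first `ϕ*` and then `ϑ*`) is the 5-cycle
`({u₁,u₅} {u₂,u₆} {u₃,u₇} {u₉,u₁₀} {u₄,u₈})`. Since the symmetric group of the 5! permutations of five
elements is generated by a 5-cycle and a transposition, the permutations `ϑ*ϕ*` and `ϕ*` generate `S₅`.
Therefore `S₅ = ⟨ϕ*, ϑ*⟩`. It follows that the above homomorphism `Φ → S₅` is surjective" (pp. 282–283);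
p. 272: "`Θ = ⟨ϑ, σ⟩` is isomorphic to the dihedral group `D₈` of order 16". Products are composed right to
left as in the source, which is Mathlib's `Equiv.Perm` multiplication.

TYPED (0-indexed: `uᵢ ↦ i − 1 : Fin 10`, the pairs of `P` numbered `0,…,4` in the printed order):
`thetaU`, `phiU`, `chiU`, `sigmaU : Equiv.Perm (Fin 10)`; `Phi = closure {ϕ,χ,ϑ,σ}`, `PhiTwo = closure {ϕ,ϑ}`,
`ThetaU = closure {ϑ,σ}`; `block : Fin 10 → Fin 5`, `rep`, `partner`; the subgroup `W` of block-preserving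
permutations (the imprimitivity subgroup of `P`) and the induced homomorphism `starHom : W →* Perm (Fin 5)`,
`π ↦ π*`; `thetaStar`, `phiStar`, `chiStar`, `sigmaStar`; `thetaSigma (a, b) = ϑ^a σ^b`.
PROVED (kernel checks only on explicit permutations of ten or five symbols — no enumeration of any group,
no `native_decide`): the generators are even (`Phi_le_alternatingGroup`), preserve `P` (`Phi_le_W`),
`⟨ϕ,ϑ⟩` is transitive (`PhiTwo_transitive`), the induced permutations are the printed ones
(`starHom_thetaW`, …), `ϑ*ϕ*` is the printed 5-cycle and `⟨ϕ*, ϑ*⟩ = S₅` (`closure_phiStar_thetaStar`, via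
Mathlib's `Equiv.Perm.closure_prime_cycle_swap`); `Θ` on `U` consists of the sixteen distinct `ϑ^a σ^b`
with `ϑ⁸ = σ² = 1`, `σϑσ = ϑ⁻¹` (`mem_ThetaU_iff`, **`card_ThetaU : Nat.card ThetaU = 16`**), `Θ ⊂ Φ`.
NOT typed: an explicit isomorphism of `Θ` with Mathlib's `DihedralGroup 8` (only order and presentation).
-/

namespace Literature.NumberTheory.Irrationality.RhinViola2001

namespace PhiGroup

open Equiv Equiv.Perm

/-! ### The four generators as permutations of `U = {u₁, …, u₁₀}` (p. 282) -/

/-- `ϑ = (u₁ u₂ u₃ u₄ u₅ u₆ u₇ u₈)(u₉ u₁₀)` as a permutation of `Fin 10` (`uᵢ ↦ i − 1`).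
[cite: RhinViola2001, §4 p. 282] -/
def thetaU : Perm (Fin 10) where
  toFun := ![1, 2, 3, 4, 5, 6, 7, 0, 9, 8]
  invFun := ![7, 0, 1, 2, 3, 4, 5, 6, 9, 8]
  left_inv x := by fin_cases x <;> rfl
  right_inv x := by fin_cases x <;> rfl

/-- `ϕ = (u₃ u₁₀)(u₇ u₉)`. [cite: RhinViola2001, §4 p. 282] -/
def phiU : Perm (Fin 10) := swap 2 9 * swap 6 8

/-- `χ = (u₂ u₃)(u₆ u₇)`. [cite: RhinViola2001, §4 p. 282] -/
def chiU : Perm (Fin 10) := swap 1 2 * swap 5 6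

/-- `σ = (u₁ u₈)(u₂ u₇)(u₃ u₆)(u₄ u₅)`. [cite: RhinViola2001, §4 p. 282] -/
def sigmaU : Perm (Fin 10) := swap 0 7 * swap 1 6 * swap 2 5 * swap 3 4

/-- `Φ = ⟨ϕ, χ, ϑ, σ⟩`, as a subgroup of the permutations of `U`. [cite: RhinViola2001, §4 p. 281 (definition of Φ), p. 282] -/
def Phi : Subgroup (Perm (Fin 10)) := Subgroup.closure {phiU, chiU, thetaU, sigmaU}

/-- The subgroup `⟨ϕ, ϑ⟩`. [cite: RhinViola2001, §4 pp. 282–284] -/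
def PhiTwo : Subgroup (Perm (Fin 10)) := Subgroup.closure {phiU, thetaU}

/-- `Θ = ⟨ϑ, σ⟩` viewed on `U`. [cite: RhinViola2001, §2 p. 272 and §4 p. 285] -/
def ThetaU : Subgroup (Perm (Fin 10)) := Subgroup.closure {thetaU, sigmaU}

/-- `⟨ϕ, ϑ⟩ ⊂ Φ`. [cite: RhinViola2001, §4 p. 283 ("H ⊂ ⟨ϕ, ϑ⟩ ⊂ Φ")] -/
theorem PhiTwo_le_Phi : PhiTwo ≤ Phi :=
  Subgroup.closure_mono fun x hx => by
    simp only [Set.mem_insert_iff, Set.mem_singleton_iff] at hx ⊢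
    tauto

/-! ### "even permutations of the set `U`": `Φ ⊂ A₁₀` (p. 282) -/

/-- `ϑ` is even (an 8-cycle times a transposition). [cite: RhinViola2001, §4 p. 282] -/
theorem sign_thetaU : sign thetaU = 1 := by decide

/-- `ϕ` is even. [cite: RhinViola2001, §4 p. 282] -/
theorem sign_phiU : sign phiU = 1 := by decide

/-- `χ` is even. [cite: RhinViola2001, §4 p. 282] -/
theorem sign_chiU : sign chiU = 1 := by decide

/-- `σ` is even. [cite: RhinViola2001, §4 p. 282] -/
theorem sign_sigmaU : sign sigmaU = 1 := by decide

/-- "Thus we have a natural embedding of the group `Φ = ⟨ϕ, χ, ϑ, σ⟩` in the alternating group `A₁₀` of the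
even permutations of `U`." [cite: RhinViola2001, §4 p. 282] -/
theorem Phi_le_alternatingGroup : Phi ≤ alternatingGroup (Fin 10) := by
  rw [Phi, Subgroup.closure_le]
  intro x hx
  simp only [Set.mem_insert_iff, Set.mem_singleton_iff] at hx
  rw [SetLike.mem_coe, mem_alternatingGroup]
  rcases hx with rfl | rfl | rfl | rfl
  · exact sign_phiU
  · exact sign_chiU
  · exact sign_thetaU
  · exact sign_sigmaU

/-! ### "`⟨ϕ, ϑ⟩` is clearly transitive over `U`" (p. 282) -/

/-- Words reaching every `uᵢ` from `u₁`: powers of `ϑ`, and `ϕϑ²`, `ϕϑ⁶` for `u₁₀`, `u₉` (plumbing).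
[cite: RhinViola2001, §4 p. 282] -/
theorem exists_word_apply_zero (y : Fin 10) :
    ∃ n : Fin 8, (thetaU ^ (n : ℕ)) 0 = y ∨ (phiU * thetaU ^ (n : ℕ)) 0 = y := by
  revert y; decide

/-- "The group `⟨ϕ, ϑ⟩` is clearly transitive over `U`, and therefore so is `Φ`." [cite: RhinViola2001, §4 p. 282] -/
theorem PhiTwo_transitive (x y : Fin 10) : ∃ π ∈ PhiTwo, π x = y := by
  have hθ : thetaU ∈ PhiTwo := Subgroup.subset_closure (by simp)
  have hϕ : phiU ∈ PhiTwo := Subgroup.subset_closure (by simp)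
  have reach : ∀ z : Fin 10, ∃ π ∈ PhiTwo, π 0 = z := by
    intro z
    obtain ⟨n, h | h⟩ := exists_word_apply_zero z
    · exact ⟨_, Subgroup.pow_mem _ hθ n, h⟩
    · exact ⟨_, Subgroup.mul_mem _ hϕ (Subgroup.pow_mem _ hθ n), h⟩
  obtain ⟨π, hπ, hx⟩ := reach x
  obtain ⟨ρ, hρ, hy⟩ := reach y
  refine ⟨ρ * π⁻¹, Subgroup.mul_mem _ hρ (Subgroup.inv_mem _ hπ), ?_⟩
  rw [Perm.mul_apply, ← hx]
  simpa using hy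

/-! ### The block system `P = {{u₁,u₅},{u₂,u₆},{u₃,u₇},{u₄,u₈},{u₉,u₁₀}}` (p. 282) -/

/-- The pair of `P` containing `uᵢ`, the five pairs numbered `0, …, 4` in the printed order.
[cite: RhinViola2001, §4 p. 282 (definition of P)] -/
def block : Fin 10 → Fin 5 := ![0, 1, 2, 3, 0, 1, 2, 3, 4, 4]

/-- The first element of each pair (`u₁, u₂, u₃, u₄, u₉`). [cite: RhinViola2001, §4 p. 282 (definition of P)] -/
def rep : Fin 5 → Fin 10 := ![0, 1, 2, 3, 8]

/-- The other element of the pair of `uᵢ` (the product of the five pair flips, an involution of `U`).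
[cite: RhinViola2001, §4 p. 282 (definition of P)] -/
def partner : Fin 10 → Fin 10 := ![4, 5, 6, 7, 0, 1, 2, 3, 9, 8]

/-- `rep b` lies in the pair `b`. [cite: RhinViola2001, §4 p. 282 (definition of P)] -/
theorem block_rep (b : Fin 5) : block (rep b) = b := by fin_cases b <;> rfl

/-- The two elements of a pair lie in the same pair. [cite: RhinViola2001, §4 p. 282 (definition of P)] -/
theorem block_partner (x : Fin 10) : block (partner x) = block x := by fin_cases x <;> rfl

/-- `partner` is an involution. [cite: RhinViola2001, §4 p. 282 (definition of P)] -/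
theorem partner_partner (x : Fin 10) : partner (partner x) = x := by fin_cases x <;> rfl

/-- The pairs have two distinct elements. [cite: RhinViola2001, §4 p. 282 (definition of P)] -/
theorem partner_ne (x : Fin 10) : partner x ≠ x := by fin_cases x <;> decide

/-- Every `uᵢ` is the first or the second element of its pair. [cite: RhinViola2001, §4 p. 282 (definition of P)] -/
theorem rep_or_partner (x : Fin 10) : x = rep (block x) ∨ x = partner (rep (block x)) := by
  fin_cases x <;> decide

/-- The pair of `x` is `{x, partner x}`. [cite: RhinViola2001, §4 p. 282 (definition of P)] -/
theorem eq_or_eq_partner {x y : Fin 10} (h : block y = block x) : y = x ∨ y = partner x := by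
  revert x y; decide

/-- "`P` is a partition of `U`" into PAIRS: three elements of one pair cannot be distinct.
[cite: RhinViola2001, §4 p. 282 (definition of P)] -/
theorem three_in_block {x y z : Fin 10} (h₁ : block y = block x) (h₂ : block z = block x) :
    x = y ∨ x = z ∨ y = z := by
  revert x y z; decide

/-- "carries every element of `P` onto an element of `P`": the block-preserving permutations of `U`.
[cite: RhinViola2001, §4 p. 282] -/
def BlockPreserving (π : Perm (Fin 10)) : Prop := ∀ x y : Fin 10, block x = block y → block (π x) = block (π y)

/-- The block-preserving permutations form a subgroup `W` of `S₁₀` (the imprimitivity subgroup of `P`; for the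
inverse: three distinct elements cannot lie in one pair). [cite: RhinViola2001, §4 p. 282] -/
def W : Subgroup (Perm (Fin 10)) where
  carrier := {π | BlockPreserving π}
  one_mem' := fun _ _ h => h
  mul_mem' := fun hπ hρ x y h => hπ _ _ (hρ _ _ h)
  inv_mem' := by
    intro π hπ x y hxy
    by_contra hne
    have hx : π (π⁻¹ x) = x := by simp
    have hy : π (π⁻¹ y) = y := by simp
    have h1 : block (π (partner (π⁻¹ x))) = block x := by
      rw [hπ _ _ (block_partner (π⁻¹ x)), hx]
    have h2 : block y = block x := hxy.symm
    have d1 : x ≠ π (partner (π⁻¹ x)) := fun h => by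
      have h' : π (π⁻¹ x) = π (partner (π⁻¹ x)) := by rw [hx]; exact h
      exact partner_ne _ (π.injective h').symm
    have d2 : x ≠ y := fun h => hne (by rw [h])
    have d3 : π (partner (π⁻¹ x)) ≠ y := fun h => by
      apply hne
      have h' : π (partner (π⁻¹ x)) = π (π⁻¹ y) := by rw [hy]; exact h
      rw [← π.injective h', block_partner]
    rcases three_in_block h1 h2 with h | h | h
    · exact d1 h
    · exact d2 h
    · exact d3 h

/-- Membership in `W` is block preservation (plumbing). [cite: RhinViola2001, §4 p. 282] -/
theorem mem_W {π : Perm (Fin 10)} : π ∈ W ↔ BlockPreserving π := Iff.rfl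

/-- `ϑ` preserves `P`. [cite: RhinViola2001, §4 p. 282] -/
theorem blockPreserving_thetaU : BlockPreserving thetaU := by unfold BlockPreserving; decide

/-- `ϕ` preserves `P`. [cite: RhinViola2001, §4 p. 282] -/
theorem blockPreserving_phiU : BlockPreserving phiU := by unfold BlockPreserving; decide

/-- `χ` preserves `P`. [cite: RhinViola2001, §4 p. 282] -/
theorem blockPreserving_chiU : BlockPreserving chiU := by unfold BlockPreserving; decide

/-- `σ` preserves `P`. [cite: RhinViola2001, §4 p. 282] -/
theorem blockPreserving_sigmaU : BlockPreserving sigmaU := by unfold BlockPreserving; decide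

/-- "the group `Φ` is imprimitive over `U`, the elements of `P` being blocks of imprimitivity, since each of
`ϕ, χ, ϑ` and `σ` carries every element of `P` onto an element of `P`." [cite: RhinViola2001, §4 p. 282] -/
theorem Phi_le_W : Phi ≤ W := by
  rw [Phi, Subgroup.closure_le]
  intro x hx
  simp only [Set.mem_insert_iff, Set.mem_singleton_iff] at hx
  rcases hx with rfl | rfl | rfl | rfl
  · exact blockPreserving_phiU
  · exact blockPreserving_chiU
  · exact blockPreserving_thetaU
  · exact blockPreserving_sigmaU

/-- `⟨ϕ, ϑ⟩ ⊂ W`. [cite: RhinViola2001, §4 p. 282] -/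
theorem PhiTwo_le_W : PhiTwo ≤ W := PhiTwo_le_Phi.trans Phi_le_W

/-! ### The induced permutations of `P` and the homomorphism `Φ → S₅` (pp. 282–283) -/

/-- `π*` as a function on the five pairs: the pair of `π(first element of the pair)`.
[cite: RhinViola2001, §4 pp. 282–283 ("the permutations of P induced by ϕ, χ, ϑ and σ")] -/
def starFun (π : Perm (Fin 10)) (b : Fin 5) : Fin 5 := block (π (rep b))

/-- For block-preserving `π`, `π` maps the pair of `x` to the pair `π*(pair of x)`.
[cite: RhinViola2001, §4 pp. 282–283] -/
theorem block_apply {π : Perm (Fin 10)} (hπ : BlockPreserving π) (x : Fin 10) :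
    block (π x) = starFun π (block x) :=
  hπ _ _ (block_rep (block x)).symm

/-- `(πρ)* = π* ρ*` for block-preserving `π`. [cite: RhinViola2001, §4 p. 283 ("extends to a homomorphism")] -/
theorem starFun_mul {π : Perm (Fin 10)} (hπ : BlockPreserving π) (ρ : Perm (Fin 10)) :
    starFun (π * ρ) = starFun π ∘ starFun ρ := by
  funext b
  simp only [starFun, Perm.mul_apply, Function.comp_apply]
  exact block_apply hπ _

/-- `1* = 1`. [cite: RhinViola2001, §4 p. 283] -/
theorem starFun_one : starFun 1 = id := funext block_rep

/-- `π*` as a permutation of the five pairs, for `π ∈ W`. [cite: RhinViola2001, §4 p. 283] -/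
def starPerm (π : W) : Perm (Fin 5) where
  toFun := starFun (π : Perm (Fin 10))
  invFun := starFun ((π⁻¹ : W) : Perm (Fin 10))
  left_inv b := by
    have h := congrFun (starFun_mul (π⁻¹ : W).2 (π : Perm (Fin 10))) b
    rw [Subgroup.coe_inv, inv_mul_cancel, starFun_one] at h
    exact h.symm
  right_inv b := by
    have h := congrFun (starFun_mul π.2 ((π⁻¹ : W) : Perm (Fin 10))) b
    rw [Subgroup.coe_inv, mul_inv_cancel, starFun_one] at h
    exact h.symm

/-- "the mapping `ϕ ↦ ϕ*`, `χ ↦ χ*`, `ϑ ↦ ϑ*` and `σ ↦ σ*` extends to a homomorphism `Φ →* S₅`" — here on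
the whole imprimitivity subgroup `W ⊃ Φ`. [cite: RhinViola2001, §4 p. 283] -/
def starHom : W →* Perm (Fin 5) where
  toFun := starPerm
  map_one' := Equiv.ext fun b => block_rep b
  map_mul' π ρ := Equiv.ext fun b => congrFun (starFun_mul π.2 (ρ : Perm (Fin 10))) b

/-- `starHom π b = block (π (rep b))` (plumbing). [cite: RhinViola2001, §4 p. 283] -/
theorem starHom_apply (π : W) (b : Fin 5) : starHom π b = block ((π : Perm (Fin 10)) (rep b)) := rfl

/-- `ϑ* = (P₁ P₂ P₃ P₄)`, the 4-cycle of the first four pairs. [cite: RhinViola2001, §4 p. 283] -/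
def thetaStar : Perm (Fin 5) where
  toFun := ![1, 2, 3, 0, 4]
  invFun := ![3, 0, 1, 2, 4]
  left_inv x := by fin_cases x <;> rfl
  right_inv x := by fin_cases x <;> rfl

/-- `ϕ* = ({u₃,u₇} {u₉,u₁₀})`. [cite: RhinViola2001, §4 p. 283] -/
def phiStar : Perm (Fin 5) := swap 2 4

/-- `χ* = ({u₂,u₆} {u₃,u₇})`. [cite: RhinViola2001, §4 p. 283] -/
def chiStar : Perm (Fin 5) := swap 1 2

/-- `σ* = ({u₁,u₅} {u₄,u₈})({u₂,u₆} {u₃,u₇})`. [cite: RhinViola2001, §4 p. 283] -/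
def sigmaStar : Perm (Fin 5) := swap 0 3 * swap 1 2

/-- `ϑ` as an element of `W`. [cite: RhinViola2001, §4 p. 282] -/
def thetaW : W := ⟨thetaU, blockPreserving_thetaU⟩

/-- `ϕ` as an element of `W`. [cite: RhinViola2001, §4 p. 282] -/
def phiW : W := ⟨phiU, blockPreserving_phiU⟩

/-- `χ` as an element of `W`. [cite: RhinViola2001, §4 p. 282] -/
def chiW : W := ⟨chiU, blockPreserving_chiU⟩

/-- `σ` as an element of `W`. [cite: RhinViola2001, §4 p. 282] -/
def sigmaW : W := ⟨sigmaU, blockPreserving_sigmaU⟩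

/-- "`ϑ*` is the permutation of `P` induced by `ϑ`." [cite: RhinViola2001, §4 p. 283] -/
theorem starHom_thetaW : starHom thetaW = thetaStar := by
  refine Equiv.ext fun b => ?_; fin_cases b <;> rfl

/-- "`ϕ*` is the permutation of `P` induced by `ϕ`." [cite: RhinViola2001, §4 p. 283] -/
theorem starHom_phiW : starHom phiW = phiStar := by
  refine Equiv.ext fun b => ?_; fin_cases b <;> rfl

/-- "`χ*` is the permutation of `P` induced by `χ`." [cite: RhinViola2001, §4 p. 283] -/
theorem starHom_chiW : starHom chiW = chiStar := by
  refine Equiv.ext fun b => ?_; fin_cases b <;> rfl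

/-- "`σ*` is the permutation of `P` induced by `σ`." [cite: RhinViola2001, §4 p. 283] -/
theorem starHom_sigmaW : starHom sigmaW = sigmaStar := by
  refine Equiv.ext fun b => ?_; fin_cases b <;> rfl

/-- "the product `ϑ*ϕ*` … is the 5-cycle `({u₁,u₅} {u₂,u₆} {u₃,u₇} {u₉,u₁₀} {u₄,u₈})`."
[cite: RhinViola2001, §4 p. 283] -/
theorem thetaStar_mul_phiStar : thetaStar * phiStar = List.formPerm [0, 1, 2, 4, 3] := by decide

/-- "Since the symmetric group of the 5! permutations of five elements is generated by a 5-cycle and a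
transposition, the permutations `ϑ*ϕ*` and `ϕ*` generate `S₅`. Therefore `S₅ = ⟨ϕ*, ϑ*⟩`."
[cite: RhinViola2001, §4 p. 283] -/
theorem closure_phiStar_thetaStar : Subgroup.closure {phiStar, thetaStar} = (⊤ : Subgroup (Perm (Fin 5))) := by
  have hcyc : IsCycle (thetaStar * phiStar) := by
    rw [thetaStar_mul_phiStar]
    exact List.isCycle_formPerm (by decide) (by decide)
  have hsupp : (thetaStar * phiStar).support = Finset.univ := by decide
  have hswap : IsSwap phiStar := ⟨2, 4, by decide, rfl⟩
  have h5 : (Fintype.card (Fin 5)).Prime := by rw [Fintype.card_fin]; norm_num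
  have htop := closure_prime_cycle_swap h5 hcyc hsupp hswap
  rw [eq_top_iff, ← htop, Subgroup.closure_le]
  rintro x hx
  simp only [Set.mem_insert_iff, Set.mem_singleton_iff] at hx
  rcases hx with rfl | rfl
  · exact Subgroup.mul_mem _ (Subgroup.subset_closure (by simp)) (Subgroup.subset_closure (by simp))
  · exact Subgroup.subset_closure (by simp)

/-! ### `Θ = ⟨ϑ, σ⟩` on `U`: the sixteen elements `ϑ^a σ^b` (p. 272) -/

/-- The sixteen elements `ϑ^a σ^b` (`a < 8`, `b < 2`). [cite: RhinViola2001, §2 p. 272 ("Θ = ⟨ϑ, σ⟩ is isomorphic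
to the dihedral group D₈ of order 16")] -/
def thetaSigma (p : Fin 8 × Fin 2) : Perm (Fin 10) := thetaU ^ (p.1 : ℕ) * sigmaU ^ (p.2 : ℕ)

/-- The dihedral relation `σϑσ = ϑ⁻¹` on `U` (with `ϑ⁸ = 1`, `σ² = 1`). [cite: RhinViola2001, §2 p. 272] -/
theorem sigma_theta_sigma : sigmaU * thetaU * sigmaU = thetaU⁻¹ := by decide

/-- `ϑ` has order 8 on `U`: `ϑ⁸ = 1` and `ϑ⁴ ≠ 1`. [cite: RhinViola2001, §2 p. 272 ((2.4): "ϑ has period 8")] -/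
theorem thetaU_pow_eight : thetaU ^ 8 = 1 ∧ thetaU ^ 4 ≠ 1 := by decide

/-- `σ² = 1` on `U`. [cite: RhinViola2001, §2 p. 272] -/
theorem sigmaU_sq : sigmaU ^ 2 = 1 := by decide

/-- The sixteen products `ϑ^a σ^b` are closed under multiplication and inversion (the dihedral normal form).
[cite: RhinViola2001, §2 p. 272] -/
theorem thetaSigma_closed :
    (∀ p q : Fin 8 × Fin 2, ∃ r : Fin 8 × Fin 2, thetaSigma p * thetaSigma q = thetaSigma r) ∧
      ∀ p : Fin 8 × Fin 2, ∃ r : Fin 8 × Fin 2, (thetaSigma p)⁻¹ = thetaSigma r := by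
  unfold thetaSigma; constructor <;> decide

/-- The sixteen products `ϑ^a σ^b` are pairwise distinct. [cite: RhinViola2001, §2 p. 272 ("of order 16")] -/
theorem thetaSigma_injective : Function.Injective thetaSigma := by
  unfold thetaSigma Function.Injective; decide

/-- `Θ` consists exactly of the sixteen products `ϑ^a σ^b`. [cite: RhinViola2001, §2 p. 272] -/
theorem mem_ThetaU_iff (π : Perm (Fin 10)) : π ∈ ThetaU ↔ ∃ p : Fin 8 × Fin 2, thetaSigma p = π := by
  have hθ : thetaU ∈ ThetaU := Subgroup.subset_closure (by simp)
  have hσ : sigmaU ∈ ThetaU := Subgroup.subset_closure (by simp)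
  -- the set of the sixteen products is a subgroup containing the generators
  let D : Subgroup (Perm (Fin 10)) :=
    { carrier := Set.range thetaSigma
      one_mem' := ⟨(0, 0), by simp [thetaSigma]⟩
      mul_mem' := by
        rintro _ _ ⟨p, rfl⟩ ⟨q, rfl⟩
        obtain ⟨r, hr⟩ := thetaSigma_closed.1 p q
        exact ⟨r, hr.symm⟩
      inv_mem' := by
        rintro _ ⟨p, rfl⟩
        obtain ⟨r, hr⟩ := thetaSigma_closed.2 p
        exact ⟨r, hr.symm⟩ }
  have hle : ThetaU ≤ D := by
    rw [ThetaU, Subgroup.closure_le]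
    rintro x hx
    simp only [Set.mem_insert_iff, Set.mem_singleton_iff] at hx
    rcases hx with rfl | rfl
    · exact ⟨(1, 0), by simp [thetaSigma]⟩
    · exact ⟨(0, 1), by simp [thetaSigma]⟩
  constructor
  · intro h; exact hle h
  · rintro ⟨p, rfl⟩
    exact Subgroup.mul_mem _ (Subgroup.pow_mem _ hθ _) (Subgroup.pow_mem _ hσ _)

/-- **"`|Θ| = 16`"** (on `U`). [cite: RhinViola2001, §2 p. 272 and §4 p. 285] -/
theorem card_ThetaU : Nat.card ThetaU = 16 := by
  have hset : (ThetaU : Set (Perm (Fin 10))) = Set.range thetaSigma := by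
    ext π
    rw [SetLike.mem_coe, mem_ThetaU_iff, Set.mem_range]
  rw [← SetLike.coe_sort_coe, hset, ← Nat.card_congr (Equiv.ofInjective thetaSigma thetaSigma_injective),
    Nat.card_prod]
  simp

/-- `Θ ⊂ Φ` (on `U`). [cite: RhinViola2001, §4 p. 285] -/
theorem ThetaU_le_Phi : ThetaU ≤ Phi := by
  rw [ThetaU, Subgroup.closure_le]
  rintro x hx
  simp only [Set.mem_insert_iff, Set.mem_singleton_iff] at hx
  rcases hx with rfl | rfl
  · exact Subgroup.subset_closure (by simp)
  · exact Subgroup.subset_closure (by simp)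

end PhiGroup

end Literature.NumberTheory.Irrationality.RhinViola2001
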